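import Mathlib.Analysis.RCLike.Basic
import HarnessLib

/-!
# BalabanUVNodes ∕ N15 — THE KING-MODEL RUNG (PART Η-a): KING's REPLACEMENT STEP OF PROPOSITION 3.6 AS A THEOREM — the η-difference of a graph value is
# «the same graph with a difference of propagators on one line», summed over the lines: RE-PAIRING of the vertex sums + ONE-FACTOR-AT-A-TIME telescoping,
# generic over finite graphs on two lattices related by a pairing with uniform fibres
# (Track A, DAG node N15 = NE2; FAN-OUT v1.1 §N15 s3 «KING-MODEL RUNG … NE2's analogue DECIDED in the model + what the curved case adds»)

HONEST FRAMING.  Count-neutral (cell `pub-ymgap`, seat `pub-ymgap-dag-n15-e` g25; `--supports stmt-QuantumFields-27366 --as helper` = K3⁸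
`SpineGivenEndpointR13SepCoPHV`).  TEMPLATE LITERATURE: C. King, *The U(1) Higgs model. I. The continuum limit*, Commun. Math. Phys. **102** (1986) 649–677
[King1986], the proof of Proposition 3.6 (the η-convergence of the localised graph values, p. 662 (3.56)), its LAST STEP pp. 664–665.  This file is the
MECHANISM of that step, generic (finite sorts, a normed field `𝕜 = ℝ` or `ℂ`); parts Η-b∕Η-c put King's slices (Props. 3.7∕3.9) and dressings ((3.46)∕(3.72))
on it BY NAME.  NOT Bałaban's non-abelian `G(U)` of [B9]; NOT a node discharge; nothing continuum ∕ ℝ⁴ ∕ OS ∕ mass-gap ∕ Clay.  0 `sorry`; standard axioms.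
Text layer of pp. 663–665 (`paper:king1986-cmp102-king-u1-higgs-i` p0015–p0017) re-read by this seat 2026-08-29.

THE PRINT.  p. 664 [PDF 16] l. −9 ff., verbatim: *«So we reduce to the case with S^c empty, i.e. we must bound |E^{(k)}(H) − E^{(k+n)}(H)|. This is done by
replacing one by one every factor in E^{(k+n)}(H) by the corresponding factor in E^{(k)}(H), and bounding the error at each step. First, we replace the
propagators on the external lines, using the following proposition [Prop. 3.8 (3.71)] …»*; p. 665 [PDF 17]: *«If we replace such a propagator in E^{(k+n)}(H),
the error is the same graph with a difference or propagators on one line. Using the method presented, this error is bounded, and Proposition 3.8 gives the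
desired factor L^{−γk}. All such propagators are replaced in this way. The sources g_{μν}(x′), h(x′) and the partition of unity function χ(x′) can be replaced
by g_{μν}(x), h(x) and χ(x) respectively, since their derivatives are uniformly bounded. The operator (3.46) can be replaced using the following bound: (3.72).
Now we replace propagators on the internal lines, using [Prop. 3.9 (3.73)–(3.75)] … First we fix the ordering I of the internal lines. If we replace a
propagator G^{η′}_{(j)}(x′, y′) by G^η_{(j)}(x, y), the error is the same graph with a difference of propagators on one line. Redoing the analysis, we see that
the degrees of some subgraphs have been reduced by γ; for γ small enough, the exponents D(H_i) − γ are still positive, and the bound proceeds as before. This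
replacement is made for every internal line, and every ordering I. Having done this, we can replace the sums of internal vertices x′ over T_{η′} by sums over
x ∈ T_η, and this gives exactly E^{(k)}(H), proving Proposition 3.6.»*  (p. 664: *«When x′ ∈ T_{η′}, we denote by x that point in T_η for which x′ ∈ B^n(x).»*)

READING (declared; print displays no general Feynman rules — OUR typing of «the factors of E(H)»).  A (localised, index-assigned) graph `H(j)`: a finite sort
`V` of internal vertices summed over the lattice `S = T_η` with weight `w = η^d` each, a finite sort `Φ` of FACTORS, each a function of the placement `σ : V → S`
(a line `ℓ` reads `G_ℓ(σ(src ℓ), σ(tgt ℓ))`; an external line, a source `g, h, χ`, a dressing (3.46), a field `A_k(w)` read one vertex): `E(H) = graphVal w f =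
Σ_{σ : V → S} w^{|V|}·Π_φ f φ σ`.  The fine graph is the same shape on `S′ = T_{η′}` (`w′ = η′^d`, factors `f′`); King's pairing `pt : S′ → S` (`x′ ↦ x`) has
UNIFORM FIBRES of `m = L^{nd}` points, `m·w′ = w`.

WHAT THIS FILE PROVES (namespace `Summit.QuantumFields.YangMills.BalabanUVNodes.N15KingModelRung.Graph`, `𝕜` an `RCLike` field).
* §1 `graphVal`; ★ `norm_graphVal_le` (termwise majorants `‖f φ σ‖ ≤ M φ σ` ⇒ `‖E‖ ≤ graphVal ‖w‖ M`, the size half of «the method presented»), `graphVal_nonneg`,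
  `graphVal_update_mul` (a scalar on ONE factor comes out).
* §2 THE RE-PAIRING IDENTITY (p. 665 «we can replace the sums of internal vertices x′ over T_{η′} by sums over x ∈ T_η …»): `card_filter_comp_eq_pow`
  (`#{σ′ : pt ∘ σ′ = σ} = m^{|V|}`), ★ `sum_comp_eq_pow_mul_sum` (`Σ_{σ′} F(pt ∘ σ′) = m^{|V|}·Σ_σ F σ`), ★★ `graphVal_repair` (`graphVal w′ (f ∘ pt) = graphVal w f`).
* §3 ONE FACTOR AT A TIME (p. 664 «replacing one by one every factor … and bounding the error at each step»): ★★ `norm_prod_sub_prod_le_sum_update` —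
  `‖Π_φ a_φ − Π_φ b_φ‖ ≤ Σ_φ Π_ψ (M[φ ↦ R_φ])_ψ` for `‖a‖, ‖b‖ ≤ M`, `‖a − b‖ ≤ R` (the φ-th summand = the product with ONE size replaced by a difference).
* §4 ★★★ THE ENGINE `norm_graphVal_sub_graphVal_le`: with sizes `M φ` valid on BOTH lattices (the fine one read through `pt`) and two-spacing rates `R φ`,
  `‖E′ − E‖ ≤ Σ_φ graphVal ‖w‖ (M[φ ↦ R_φ])` — A SUM OVER THE FACTORS OF THE SAME GRAPH WITH ONE FACTOR's SIZE REPLACED BY ITS RATE (p. 665); ★★ `…_of_ratio`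
  (rates `R_φ = θ_φ·M_φ`: `‖E′ − E‖ ≤ (Σ_φ θ_φ)·graphVal ‖w‖ M` — the form for the sources, the dressings (3.72), the external lines (3.71));
  `norm_graphVal_le_repaired` (the fine graph's size in coarse currency).
* §5 THE LINE ∕ SITE SPELLING `lsFactor`∕`graphValLS` (lines `G_ℓ(σ(src ℓ), σ(tgt ℓ))` ⊕ one-vertex factors `u_υ(σ(vtx υ))`), `update_lsFactor_inl∕_inr`,
  ★★★ `norm_graphValLS_sub_le` — KERNEL-LEVEL hypotheses `‖G_ℓ‖, ‖G′_ℓ ∘ pt‖ ≤ P_ℓ`, `‖G′_ℓ − G_ℓ ∘ pt‖ ≤ Q_ℓ` (and `p_υ`, `q_υ`): `‖E′ − E‖ ≤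
  Σ_ℓ 𝔼(P[ℓ ↦ Q_ℓ]; p) + Σ_υ 𝔼(P; p[υ ↦ q_υ])` — the shape parts Η-b∕Η-c feed with Prop. 3.7 sizes, Prop. 3.9∕3.8 rates and (3.72); `…_of_ratio`.

HONEST SCOPE.  (a) The replacement step and its bound ONLY — the `S^c = ∅` case of the proof of Proposition 3.6 (p. 664); the POWER COUNTING that bounds the
majorant graph values `𝔼(…)` by the tree decay of (3.56) ((3.67)–(3.70), degrees `D(H_i)`, §3.5 renormalised graphs) is NOT here (part Μ has the letters
(3.67)–(3.70); the degree bookkeeping is not typed).  (b) No orderings `I`∕(3.58)–(3.61) are needed for the step itself; the bound is enumeration-free.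
(c) Generic finite sorts; lattices, slices, constants of [King1986] enter in parts Η-b∕Η-c.  Locators: [King1986] Prop. 3.6 (3.56) p.662, pp.664–665 (the
replacement step), p.664 (pairing «x′ ∈ B^n(x)»), (3.71) p.664, (3.72)∕(3.73) p.665.
-/

noncomputable section
namespace Summit.QuantumFields.YangMills.BalabanUVNodes.N15KingModelRung.Graph

open scoped BigOperators
open Finset

variable {𝕜 : Type*} [RCLike 𝕜]

/-! ## §1 Graph values and their termwise majorants -/

section GraphVal
variable {V S Φ : Type*} [Fintype V] [DecidableEq V] [Fintype S] [Fintype Φ]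

/-- **THE VALUE OF A (localised, index-assigned) GRAPH** `E(H) = Σ_{σ : V → S} w^{|V|}·Π_φ f φ σ`: internal vertices `V` summed over the lattice `S` with
weight `w` each (`w = η^d`), one factor per line ∕ external line ∕ source ∕ dressing, each a function of the vertex placement `σ` (module docstring, READING).
[cite: King1986, (3.55)–(3.56) p.662, p.664 («replacing one by one every factor in E^{(k+n)}(H)»)] -/
def graphVal (w : 𝕜) (f : Φ → (V → S) → 𝕜) : 𝕜 := ∑ σ : V → S, w ^ Fintype.card V * ∏ φ, f φ σ

/-- ★ **THE SIZE HALF OF «THE METHOD PRESENTED»** (p. 664: *«We get an upper bound for this expression by replacing every propagator by the bounds given in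
Proposition 3.7 and Theorem 3.3, and bounding vertex functions appropriately»*): termwise majorants `‖f φ σ‖ ≤ M φ σ` give `‖E(H)‖ ≤ 𝔼(H) = graphVal ‖w‖ M`,
the SAME graph run on the majorants. [cite: King1986, p.664 (proof of Prop. 3.6)] -/
theorem norm_graphVal_le (w : 𝕜) (f : Φ → (V → S) → 𝕜) (M : Φ → (V → S) → ℝ) (hM : ∀ φ σ, ‖f φ σ‖ ≤ M φ σ) :
    ‖graphVal w f‖ ≤ graphVal ‖w‖ M := by
  unfold graphVal
  refine (norm_sum_le _ _).trans (sum_le_sum fun σ _ => ?_)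
  rw [norm_mul, norm_pow, norm_prod]
  exact mul_le_mul_of_nonneg_left (prod_le_prod (fun _ _ => norm_nonneg _) fun φ _ => hM φ σ) (pow_nonneg (norm_nonneg _) _)

/-- the majorant graph value is nonnegative for nonnegative data. [folklore] -/
theorem graphVal_nonneg {ω : ℝ} (hω : 0 ≤ ω) {M : Φ → (V → S) → ℝ} (hM : ∀ φ σ, 0 ≤ M φ σ) : 0 ≤ graphVal ω M :=
  sum_nonneg fun σ _ => mul_nonneg (pow_nonneg hω _) (prod_nonneg fun φ _ => hM φ σ)

/-- **a scalar on ONE factor comes out**: `graphVal ω (M[φ ↦ c·M_φ]) = c·graphVal ω M` (multilinearity in the factors). [folklore] -/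
theorem graphVal_update_mul [DecidableEq Φ] (ω : ℝ) (M : Φ → (V → S) → ℝ) (φ : Φ) (c : ℝ) :
    graphVal ω (Function.update M φ (fun σ => c * M φ σ)) = c * graphVal ω M := by
  unfold graphVal
  rw [mul_sum]
  refine sum_congr rfl fun σ _ => ?_
  have h : ∏ ψ, Function.update M φ (fun σ => c * M φ σ) ψ σ = c * ∏ ψ, M ψ σ := by
    rw [← Finset.prod_apply, prod_update_of_mem (mem_univ φ), Pi.mul_apply, Finset.prod_apply, sdiff_singleton_eq_erase, mul_assoc,
      mul_prod_erase (s := univ) (f := fun ψ => M ψ σ) (mem_univ φ)]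
  rw [h]; ring
end GraphVal

/-! ## §2 The re-pairing identity: «we can replace the sums of internal vertices x′ over T_{η′} by sums over x ∈ T_η» -/

section Repair
variable {V S S' : Type*} [Fintype V] [DecidableEq V] [Fintype S] [DecidableEq S] [Fintype S']

omit [Fintype S] in
/-- **the placements over a given coarse placement**: if every fibre of the pairing `pt` has `m` points (King: the `L^{nd}` points of `B^n(x)`), then
`#{σ′ : V → S′ : pt ∘ σ′ = σ} = m^{|V|}`. [cite: King1986, p.664 («x′ ∈ B^n(x)»)] -/
theorem card_filter_comp_eq_pow (pt : S' → S) {m : ℕ} (hfib : ∀ x : S, (univ.filter fun x' : S' => pt x' = x).card = m) (σ : V → S) :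
    (univ.filter fun σ' : V → S' => pt ∘ σ' = σ).card = m ^ Fintype.card V := by
  classical
  have h1 : (univ.filter fun σ' : V → S' => pt ∘ σ' = σ).card = Fintype.card {σ' : V → S' // ∀ v, pt (σ' v) = σ v} := by
    rw [Fintype.card_subtype]
    congr 1
    ext σ'
    simp only [mem_filter, mem_univ, true_and, funext_iff, Function.comp_apply]
  rw [h1, Fintype.card_congr (Equiv.subtypePiEquivPi (p := fun v (x' : S') => pt x' = σ v)), Fintype.card_pi]
  have h2 : ∀ v : V, Fintype.card {x' : S' // pt x' = σ v} = m := fun v => by rw [Fintype.card_subtype, hfib]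
  simp_rw [h2, prod_const, card_univ]

/-- ★ **THE RE-PAIRING OF THE VERTEX SUMS**: `Σ_{σ′ : V → S′} F(pt ∘ σ′) = m^{|V|}·Σ_{σ : V → S} F σ` — each coarse placement is hit by exactly `m^{|V|}` fine
ones. [cite: King1986, p.665 («we can replace the sums of internal vertices x′ over T_{η′} by sums over x ∈ T_η»)] -/
theorem sum_comp_eq_pow_mul_sum (pt : S' → S) {m : ℕ} (hfib : ∀ x : S, (univ.filter fun x' : S' => pt x' = x).card = m)
    (F : (V → S) → 𝕜) : ∑ σ' : V → S', F (pt ∘ σ') = (m : 𝕜) ^ Fintype.card V * ∑ σ : V → S, F σ := by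
  classical
  rw [← sum_fiberwise_of_maps_to (s := (univ : Finset (V → S'))) (t := (univ : Finset (V → S))) (g := fun σ' => pt ∘ σ')
    (fun _ _ => mem_univ _), mul_sum]
  refine sum_congr rfl fun σ _ => ?_
  rw [sum_congr rfl fun σ' hσ' => by rw [(mem_filter.1 hσ').2], sum_const, card_filter_comp_eq_pow pt hfib σ, nsmul_eq_mul, Nat.cast_pow]

variable {Φ : Type*} [Fintype Φ]

/-- ★★ **«… AND THIS GIVES EXACTLY E^{(k)}(H)»**: once every factor of the fine graph reads the coarse point (`f′ φ σ′ = f φ (pt ∘ σ′)`), the fine graph value with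
vertex weight `w′` IS the coarse one with weight `w = m·w′` (`L^{nd}·η′^d = η^d`). [cite: King1986, p.665 («Having done this, we can replace the sums of internal
vertices x′ over T_{η′} by sums over x ∈ T_η, and this gives exactly E^{(k)}(H)»)] -/
theorem graphVal_repair (pt : S' → S) {m : ℕ} (hfib : ∀ x : S, (univ.filter fun x' : S' => pt x' = x).card = m) {w w' : 𝕜}
    (hw : (m : 𝕜) * w' = w) (f : Φ → (V → S) → 𝕜) :
    graphVal w' (fun φ σ' => f φ (pt ∘ σ')) = graphVal w f := by
  have h := sum_comp_eq_pow_mul_sum (𝕜 := 𝕜) pt hfib (fun σ : V → S => w' ^ Fintype.card V * ∏ φ, f φ σ)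
  unfold graphVal
  rw [h, mul_sum]
  refine sum_congr rfl fun σ _ => ?_
  rw [← mul_assoc, ← mul_pow, hw]

/-- the weight bookkeeping in real currency: `m·w′ = w` in `𝕜` gives `m·‖w′‖ = ‖w‖`. [folklore] -/
theorem norm_weight_repair {m : ℕ} {w w' : 𝕜} (hw : (m : 𝕜) * w' = w) : (m : ℝ) * ‖w'‖ = ‖w‖ := by
  rw [← hw, norm_mul, RCLike.norm_natCast]

/-- **the fine graph's SIZE in coarse currency**: majorants read through the pairing (`‖f′ φ σ′‖ ≤ M φ (pt ∘ σ′)`) bound the fine graph value by the COARSE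
majorant graph value `graphVal ‖w‖ M` (`m·w′ = w`). [cite: King1986, p.664 (proof of Prop. 3.6), p.665] -/
theorem norm_graphVal_le_repaired (pt : S' → S) {m : ℕ} (hfib : ∀ x : S, (univ.filter fun x' : S' => pt x' = x).card = m) {w w' : 𝕜}
    (hw : (m : 𝕜) * w' = w) (f' : Φ → (V → S') → 𝕜) (M : Φ → (V → S) → ℝ) (hM' : ∀ φ σ', ‖f' φ σ'‖ ≤ M φ (pt ∘ σ')) :
    ‖graphVal w' f'‖ ≤ graphVal ‖w‖ M := by
  refine (norm_graphVal_le w' f' (fun φ σ' => M φ (pt ∘ σ')) hM').trans (le_of_eq ?_)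
  exact graphVal_repair (𝕜 := ℝ) pt hfib (norm_weight_repair hw) M
end Repair

/-! ## §3 One factor at a time -/

section Telescope
variable {Φ : Type*} [DecidableEq Φ]

/-- ★★ **«REPLACING ONE BY ONE EVERY FACTOR … AND BOUNDING THE ERROR AT EACH STEP»**: for factors `a_φ`, `b_φ ∈ 𝕜` with common sizes `‖a_φ‖, ‖b_φ‖ ≤ M_φ` and
differences `‖a_φ − b_φ‖ ≤ R_φ`, `‖Π_{φ∈s} a_φ − Π_{φ∈s} b_φ‖ ≤ Σ_{φ∈s} Π_{ψ∈s} (M[φ ↦ R_φ])_ψ` — the φ-th summand is the same product with the size of ONE factor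
replaced by its difference. [cite: King1986, p.664 (proof of Prop. 3.6, «replacing one by one every factor»)] -/
theorem norm_prod_sub_prod_le_sum_update (s : Finset Φ) (a b : Φ → 𝕜) (M R : Φ → ℝ) (ha : ∀ φ ∈ s, ‖a φ‖ ≤ M φ)
    (hb : ∀ φ ∈ s, ‖b φ‖ ≤ M φ) (hR : ∀ φ ∈ s, ‖a φ - b φ‖ ≤ R φ) :
    ‖∏ φ ∈ s, a φ - ∏ φ ∈ s, b φ‖ ≤ ∑ φ ∈ s, ∏ ψ ∈ s, Function.update M φ (R φ) ψ := by
  induction s using Finset.induction_on with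
  | empty => simp
  | insert i s hi ih =>
    have ha' : ∀ φ ∈ s, ‖a φ‖ ≤ M φ := fun φ hφ => ha φ (mem_insert_of_mem hφ)
    have hb' : ∀ φ ∈ s, ‖b φ‖ ≤ M φ := fun φ hφ => hb φ (mem_insert_of_mem hφ)
    have hR' : ∀ φ ∈ s, ‖a φ - b φ‖ ≤ R φ := fun φ hφ => hR φ (mem_insert_of_mem hφ)
    have hih := ih ha' hb' hR'
    rw [prod_insert hi, prod_insert hi, sum_insert hi]
    have hsplit : a i * ∏ φ ∈ s, a φ - b i * ∏ φ ∈ s, b φ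
        = a i * (∏ φ ∈ s, a φ - ∏ φ ∈ s, b φ) + (a i - b i) * ∏ φ ∈ s, b φ := by ring
    have h1 : ∏ ψ ∈ insert i s, Function.update M i (R i) ψ = R i * ∏ ψ ∈ s, M ψ := by
      rw [prod_insert hi, Function.update_self]
      congr 1
      exact prod_congr rfl fun ψ hψ => by rw [Function.update_of_ne (ne_of_mem_of_not_mem hψ hi)]
    have h2 : ∀ φ ∈ s, ∏ ψ ∈ insert i s, Function.update M φ (R φ) ψ = M i * ∏ ψ ∈ s, Function.update M φ (R φ) ψ := fun φ hφ => by
      rw [prod_insert hi, Function.update_of_ne (ne_of_mem_of_not_mem hφ hi).symm]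
    rw [hsplit, h1, sum_congr rfl h2, ← mul_sum]
    have hB : ‖∏ φ ∈ s, b φ‖ ≤ ∏ ψ ∈ s, M ψ := by
      rw [norm_prod]; exact prod_le_prod (fun _ _ => norm_nonneg _) hb'
    calc ‖a i * (∏ φ ∈ s, a φ - ∏ φ ∈ s, b φ) + (a i - b i) * ∏ φ ∈ s, b φ‖
        ≤ ‖a i‖ * ‖∏ φ ∈ s, a φ - ∏ φ ∈ s, b φ‖ + ‖a i - b i‖ * ‖∏ φ ∈ s, b φ‖ := by
          refine (norm_add_le _ _).trans ?_; rw [norm_mul, norm_mul]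
      _ ≤ M i * (∑ φ ∈ s, ∏ ψ ∈ s, Function.update M φ (R φ) ψ) + R i * ∏ ψ ∈ s, M ψ :=
          add_le_add (mul_le_mul (ha i (mem_insert_self i s)) hih (norm_nonneg _) ((norm_nonneg _).trans (ha i (mem_insert_self i s))))
            (mul_le_mul (hR i (mem_insert_self i s)) hB (norm_nonneg _) ((norm_nonneg _).trans (hR i (mem_insert_self i s))))
      _ = R i * ∏ ψ ∈ s, M ψ + M i * ∑ φ ∈ s, ∏ ψ ∈ s, Function.update M φ (R φ) ψ := by ring

/-- the whole-sort form (`s = univ`). [cite: King1986, p.664 (proof of Prop. 3.6)] -/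
theorem norm_prod_sub_prod_le_sum_update_univ [Fintype Φ] (a b : Φ → 𝕜) (M R : Φ → ℝ) (ha : ∀ φ, ‖a φ‖ ≤ M φ) (hb : ∀ φ, ‖b φ‖ ≤ M φ)
    (hR : ∀ φ, ‖a φ - b φ‖ ≤ R φ) : ‖∏ φ, a φ - ∏ φ, b φ‖ ≤ ∑ φ, ∏ ψ, Function.update M φ (R φ) ψ :=
  norm_prod_sub_prod_le_sum_update univ a b M R (fun φ _ => ha φ) (fun φ _ => hb φ) fun φ _ => hR φ

/-- pointwise reading of a replaced factor family at a placement. [folklore] -/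
theorem update_apply_placement {V S : Type*} (M : Φ → (V → S) → ℝ) (φ : Φ) (R : (V → S) → ℝ) (ψ : Φ) (τ : V → S) :
    Function.update M φ R ψ τ = Function.update (fun ψ => M ψ τ) φ (R τ) ψ := by
  by_cases h : ψ = φ
  · subst h; rw [Function.update_self, Function.update_self]
  · rw [Function.update_of_ne h, Function.update_of_ne h]
end Telescope

/-! ## §4 The engine: «the error is the same graph with a difference of propagators on one line» -/

section Engine
variable {V S S' Φ : Type*} [Fintype V] [DecidableEq V] [Fintype S] [DecidableEq S] [Fintype S'] [Fintype Φ] [DecidableEq Φ]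

/-- ★★★ **KING's REPLACEMENT STEP AS A THEOREM (the engine)**.  Two graphs of the same shape: `E = graphVal w f` on `S` (`T_η`) and `E′ = graphVal w′ f′` on
`S′` (`T_{η′}`), a pairing `pt : S′ → S` with uniform fibres of `m` points and `m·w′ = w`; termwise SIZES `M φ` valid on both lattices (the fine one read
through the pairing: `‖f′ φ σ′‖ ≤ M φ (pt ∘ σ′)`) and two-spacing RATES `‖f′ φ σ′ − f φ (pt ∘ σ′)‖ ≤ R φ (pt ∘ σ′)`.  THEN
`‖E′ − E‖ ≤ Σ_φ graphVal ‖w‖ (M[φ ↦ R_φ])` — a sum over the factors of THE SAME (coarse, majorant) GRAPH WITH THE SIZE OF ONE FACTOR REPLACED BY ITS RATE.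
Proof = §2 (re-pair `E` onto the fine placements) + §3 (telescope at each placement) + §2 again (re-pair the majorants back).
[cite: King1986, pp.664–665 (proof of Prop. 3.6: «replacing one by one every factor … the error is the same graph with a difference of propagators on one
line … we can replace the sums of internal vertices x′ over T_{η′} by sums over x ∈ T_η, and this gives exactly E^{(k)}(H)»)] -/
theorem norm_graphVal_sub_graphVal_le (pt : S' → S) {m : ℕ} (hfib : ∀ x : S, (univ.filter fun x' : S' => pt x' = x).card = m)
    {w w' : 𝕜} (hw : (m : 𝕜) * w' = w) (f : Φ → (V → S) → 𝕜) (f' : Φ → (V → S') → 𝕜) (M R : Φ → (V → S) → ℝ)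
    (hM : ∀ φ σ, ‖f φ σ‖ ≤ M φ σ) (hM' : ∀ φ σ', ‖f' φ σ'‖ ≤ M φ (pt ∘ σ'))
    (hR : ∀ φ σ', ‖f' φ σ' - f φ (pt ∘ σ')‖ ≤ R φ (pt ∘ σ')) :
    ‖graphVal w' f' - graphVal w f‖ ≤ ∑ φ, graphVal ‖w‖ (Function.update M φ (R φ)) := by
  rw [← graphVal_repair pt hfib hw f]
  unfold graphVal
  rw [← sum_sub_distrib]
  have hωw : ((m : ℝ)) * ‖w'‖ = ‖w‖ := norm_weight_repair hw
  calc ‖∑ σ' : V → S', (w' ^ Fintype.card V * ∏ φ, f' φ σ' - w' ^ Fintype.card V * ∏ φ, f φ (pt ∘ σ'))‖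
      ≤ ∑ σ' : V → S', ‖w'‖ ^ Fintype.card V * ∑ φ, ∏ ψ, Function.update M φ (R φ) ψ (pt ∘ σ') := by
        refine (norm_sum_le _ _).trans (sum_le_sum fun σ' _ => ?_)
        rw [← mul_sub, norm_mul, norm_pow]
        refine mul_le_mul_of_nonneg_left ?_ (pow_nonneg (norm_nonneg _) _)
        have h := norm_prod_sub_prod_le_sum_update_univ (fun φ => f' φ σ') (fun φ => f φ (pt ∘ σ')) (fun ψ => M ψ (pt ∘ σ'))
          (fun φ => R φ (pt ∘ σ')) (fun φ => hM' φ σ') (fun φ => hM φ (pt ∘ σ')) (fun φ => hR φ σ')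
        refine h.trans (le_of_eq (sum_congr rfl fun φ _ => prod_congr rfl fun ψ _ => ?_))
        rw [update_apply_placement]
    _ = ∑ φ, ∑ σ' : V → S', ‖w'‖ ^ Fintype.card V * ∏ ψ, Function.update M φ (R φ) ψ (pt ∘ σ') := by
        rw [sum_comm]; exact sum_congr rfl fun σ' _ => mul_sum _ _ _
    _ = ∑ φ, graphVal ‖w‖ (Function.update M φ (R φ)) := by
        refine sum_congr rfl fun φ _ => ?_
        exact graphVal_repair (𝕜 := ℝ) pt hfib hωw (Function.update M φ (R φ))

/-- ★★ **RATES PROPORTIONAL TO SIZES** (the sources: *«their derivatives are uniformly bounded»* ⇒ rate `O(η)`×size; the dressings (3.46): size `1`, rate (3.72);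
the external lines: (3.71) vs (3.2)): if `‖f′ φ σ′ − f φ (pt ∘ σ′)‖ ≤ θ_φ·M φ (pt ∘ σ′)` then `‖E′ − E‖ ≤ (Σ_φ θ_φ)·graphVal ‖w‖ M`.
[cite: King1986, p.665 («can be replaced … since their derivatives are uniformly bounded», (3.72))] -/
theorem norm_graphVal_sub_graphVal_le_of_ratio (pt : S' → S) {m : ℕ} (hfib : ∀ x : S, (univ.filter fun x' : S' => pt x' = x).card = m)
    {w w' : 𝕜} (hw : (m : 𝕜) * w' = w) (f : Φ → (V → S) → 𝕜) (f' : Φ → (V → S') → 𝕜) (M : Φ → (V → S) → ℝ) (θ : Φ → ℝ)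
    (hM : ∀ φ σ, ‖f φ σ‖ ≤ M φ σ) (hM' : ∀ φ σ', ‖f' φ σ'‖ ≤ M φ (pt ∘ σ'))
    (hR : ∀ φ σ', ‖f' φ σ' - f φ (pt ∘ σ')‖ ≤ θ φ * M φ (pt ∘ σ')) :
    ‖graphVal w' f' - graphVal w f‖ ≤ (∑ φ, θ φ) * graphVal ‖w‖ M := by
  refine (norm_graphVal_sub_graphVal_le pt hfib hw f f' M (fun φ σ => θ φ * M φ σ) hM hM' hR).trans (le_of_eq ?_)
  rw [sum_mul]
  exact sum_congr rfl fun φ _ => graphVal_update_mul ‖w‖ M φ (θ φ)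
end Engine

/-! ## §5 The line ∕ site spelling: internal lines `G_ℓ(σ(src ℓ), σ(tgt ℓ))` and one-vertex factors `u_υ(σ(vtx υ))` -/

section Lines
variable {V S S' Λ Υ : Type*}

/-- **THE FACTORS OF A GRAPH WITH INTERNAL LINES AND ONE-VERTEX FACTORS**: the line `ℓ` from `src ℓ` to `tgt ℓ` carries the kernel `G_ℓ` (a propagator
`G_k`, `G_k(□′)`, a slice `G^η_{(j_ℓ)}` of (3.59), or a derivative of one), the one-vertex factor `υ` sits at `vtx υ` and carries `u_υ` (an external line
`a_kG_kQ_k^*(x, z)` with its unit point `z` fixed, a source `g, h, χ`, a dressing (3.46), a background field). [cite: King1986, (3.55)–(3.59) pp.662–663,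
(3.46) p.661, (3.71) p.664] -/
def lsFactor {T : Type*} {𝕂 : Type*} (src tgt : Λ → V) (G : Λ → T → T → 𝕂) (vtx : Υ → V) (u : Υ → T → 𝕂) : Λ ⊕ Υ → (V → T) → 𝕂
  | Sum.inl ℓ => fun σ => G ℓ (σ (src ℓ)) (σ (tgt ℓ))
  | Sum.inr υ => fun σ => u υ (σ (vtx υ))

/-- reading a line factor. [cite: King1986, (3.59) p.663] -/
@[simp] theorem lsFactor_inl {T 𝕂 : Type*} (src tgt : Λ → V) (G : Λ → T → T → 𝕂) (vtx : Υ → V) (u : Υ → T → 𝕂) (ℓ : Λ) (σ : V → T) :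
    lsFactor src tgt G vtx u (Sum.inl ℓ) σ = G ℓ (σ (src ℓ)) (σ (tgt ℓ)) := rfl

/-- reading a one-vertex factor. [cite: King1986, (3.46) p.661, (3.71) p.664] -/
@[simp] theorem lsFactor_inr {T 𝕂 : Type*} (src tgt : Λ → V) (G : Λ → T → T → 𝕂) (vtx : Υ → V) (u : Υ → T → 𝕂) (υ : Υ) (σ : V → T) :
    lsFactor src tgt G vtx u (Sum.inr υ) σ = u υ (σ (vtx υ)) := rfl

variable [Fintype V] [DecidableEq V] [Fintype Λ] [Fintype Υ]

/-- **THE GRAPH VALUE IN THE LINE ∕ SITE SPELLING** `E(H) = Σ_σ w^{|V|}·Π_ℓ G_ℓ(σ(src ℓ), σ(tgt ℓ))·Π_υ u_υ(σ(vtx υ))`. [cite: King1986, (3.55)–(3.59) pp.662–663] -/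
def graphValLS {T : Type*} [Fintype T] {𝕂 : Type*} [CommSemiring 𝕂] (w : 𝕂) (src tgt : Λ → V) (G : Λ → T → T → 𝕂) (vtx : Υ → V)
    (u : Υ → T → 𝕂) : 𝕂 :=
  ∑ σ : V → T, w ^ Fintype.card V * ((∏ ℓ, G ℓ (σ (src ℓ)) (σ (tgt ℓ))) * ∏ υ, u υ (σ (vtx υ)))

/-- the line ∕ site spelling IS `graphVal` of `lsFactor` (`Π` over `Λ ⊕ Υ` splits). [folklore] -/
theorem graphValLS_eq_graphVal {T : Type*} [Fintype T] (w : 𝕜) (src tgt : Λ → V) (G : Λ → T → T → 𝕜) (vtx : Υ → V) (u : Υ → T → 𝕜) :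
    graphValLS w src tgt G vtx u = graphVal w (lsFactor src tgt G vtx u) := by
  unfold graphValLS graphVal
  refine sum_congr rfl fun σ _ => ?_
  rw [Fintype.prod_sum_type]
  rfl

variable [DecidableEq Λ] [DecidableEq Υ]

omit [Fintype V] [DecidableEq V] [Fintype Λ] [Fintype Υ] in
/-- replacing the majorant of ONE LINE. [folklore] -/
theorem update_lsFactor_inl (src tgt : Λ → V) (P : Λ → S → S → ℝ) (vtx : Υ → V) (p : Υ → S → ℝ) (ℓ : Λ) (Q : S → S → ℝ) :
    Function.update (lsFactor src tgt P vtx p) (Sum.inl ℓ) (fun σ => Q (σ (src ℓ)) (σ (tgt ℓ)))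
      = lsFactor src tgt (Function.update P ℓ Q) vtx p := by
  funext ψ σ
  rcases ψ with ℓ' | υ
  · by_cases h : ℓ' = ℓ
    · subst h; rw [Function.update_self, lsFactor_inl, Function.update_self]
    · rw [Function.update_of_ne (fun h' => h (Sum.inl_injective h')), lsFactor_inl, lsFactor_inl, Function.update_of_ne h]
  · rw [Function.update_of_ne Sum.inr_ne_inl, lsFactor_inr, lsFactor_inr]

omit [Fintype V] [DecidableEq V] [Fintype Λ] [Fintype Υ] in
/-- replacing the majorant of ONE one-vertex factor. [folklore] -/
theorem update_lsFactor_inr (src tgt : Λ → V) (P : Λ → S → S → ℝ) (vtx : Υ → V) (p : Υ → S → ℝ) (υ : Υ) (q : S → ℝ) :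
    Function.update (lsFactor src tgt P vtx p) (Sum.inr υ) (fun σ => q (σ (vtx υ)))
      = lsFactor src tgt P vtx (Function.update p υ q) := by
  funext ψ σ
  rcases ψ with ℓ | υ'
  · rw [Function.update_of_ne Sum.inl_ne_inr, lsFactor_inl, lsFactor_inl]
  · by_cases h : υ' = υ
    · subst h; rw [Function.update_self, lsFactor_inr, Function.update_self]
    · rw [Function.update_of_ne (fun h' => h (Sum.inr_injective h')), lsFactor_inr, lsFactor_inr, Function.update_of_ne h]

variable [Fintype S] [DecidableEq S] [Fintype S']

/-- ★★★ **THE ENGINE WITH KERNEL-LEVEL HYPOTHESES** — the form parts Η-b∕Η-c feed.  Coarse lines `G_ℓ` on `S`, fine lines `G′_ℓ` on `S′`, coarse∕fine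
one-vertex factors `u_υ`, `u′_υ`; SIZES valid on both lattices in coarse currency (`‖G_ℓ(x, y)‖ ≤ P_ℓ(x, y)`, `‖G′_ℓ(x′, y′)‖ ≤ P_ℓ(x, y)` with `x = pt x′`
— Prop. 3.7 *«if we replace G^η_{(j)} by G^{η′}_{(j)} throughout … the bounds are valid»*), RATES `‖G′_ℓ(x′, y′) − G_ℓ(x, y)‖ ≤ Q_ℓ(x, y)` (Prop. 3.9 (3.73)),
`‖u′_υ(x′) − u_υ(x)‖ ≤ q_υ(x)` ((3.71), (3.72), the sources).  THEN
`‖E′ − E‖ ≤ Σ_ℓ 𝔼(P[ℓ ↦ Q_ℓ]; p) + Σ_υ 𝔼(P; p[υ ↦ q_υ])`, `𝔼 = graphValLS ‖w‖ …` the majorant graph — «the same graph with a difference of propagators on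
one line», summed over the lines, plus the same with the difference on one one-vertex factor.
[cite: King1986, pp.664–665 (proof of Prop. 3.6), Prop. 3.7 p.663 («Furthermore …»), (3.71) p.664, (3.72)–(3.73) p.665] -/
theorem norm_graphValLS_sub_le (pt : S' → S) {m : ℕ} (hfib : ∀ x : S, (univ.filter fun x' : S' => pt x' = x).card = m)
    {w w' : 𝕜} (hw : (m : 𝕜) * w' = w) (src tgt : Λ → V) (vtx : Υ → V)
    (G : Λ → S → S → 𝕜) (G' : Λ → S' → S' → 𝕜) (P Q : Λ → S → S → ℝ)
    (hP : ∀ ℓ x y, ‖G ℓ x y‖ ≤ P ℓ x y) (hP' : ∀ ℓ x' y', ‖G' ℓ x' y'‖ ≤ P ℓ (pt x') (pt y'))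
    (hQ : ∀ ℓ x' y', ‖G' ℓ x' y' - G ℓ (pt x') (pt y')‖ ≤ Q ℓ (pt x') (pt y'))
    (u : Υ → S → 𝕜) (u' : Υ → S' → 𝕜) (p q : Υ → S → ℝ)
    (hp : ∀ υ x, ‖u υ x‖ ≤ p υ x) (hp' : ∀ υ x', ‖u' υ x'‖ ≤ p υ (pt x')) (hq : ∀ υ x', ‖u' υ x' - u υ (pt x')‖ ≤ q υ (pt x')) :
    ‖graphValLS w' src tgt G' vtx u' - graphValLS w src tgt G vtx u‖
      ≤ ∑ ℓ, graphValLS ‖w‖ src tgt (Function.update P ℓ (Q ℓ)) vtx p + ∑ υ, graphValLS ‖w‖ src tgt P vtx (Function.update p υ (q υ)) := by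
  rw [graphValLS_eq_graphVal, graphValLS_eq_graphVal]
  have hM : ∀ φ σ, ‖lsFactor src tgt G vtx u φ σ‖ ≤ lsFactor src tgt P vtx p φ σ := by
    rintro (ℓ | υ) σ
    · exact hP ℓ _ _
    · exact hp υ _
  have hM' : ∀ φ σ', ‖lsFactor src tgt G' vtx u' φ σ'‖ ≤ lsFactor src tgt P vtx p φ (pt ∘ σ') := by
    rintro (ℓ | υ) σ'
    · exact hP' ℓ _ _
    · exact hp' υ _
  have hR : ∀ φ σ', ‖lsFactor src tgt G' vtx u' φ σ' - lsFactor src tgt G vtx u φ (pt ∘ σ')‖ ≤ lsFactor src tgt Q vtx q φ (pt ∘ σ') := by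
    rintro (ℓ | υ) σ'
    · exact hQ ℓ _ _
    · exact hq υ _
  refine (norm_graphVal_sub_graphVal_le pt hfib hw _ _ (lsFactor src tgt P vtx p) (lsFactor src tgt Q vtx q) hM hM' hR).trans (le_of_eq ?_)
  rw [Fintype.sum_sum_type]
  congr 1
  · refine sum_congr rfl fun ℓ _ => ?_
    rw [graphValLS_eq_graphVal (𝕜 := ℝ), ← update_lsFactor_inl]
    rfl
  · refine sum_congr rfl fun υ _ => ?_
    rw [graphValLS_eq_graphVal (𝕜 := ℝ), ← update_lsFactor_inr]
    rfl

/-- ★★ **THE PROPORTIONAL FORM IN THE LINE ∕ SITE SPELLING**: rates `Q_ℓ = θ_ℓ·P_ℓ`, `q_υ = ϑ_υ·p_υ` give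
`‖E′ − E‖ ≤ (Σ_ℓ θ_ℓ + Σ_υ ϑ_υ)·𝔼(P; p)`. [cite: King1986, p.665 (proof of Prop. 3.6)] -/
theorem norm_graphValLS_sub_le_of_ratio (pt : S' → S) {m : ℕ} (hfib : ∀ x : S, (univ.filter fun x' : S' => pt x' = x).card = m)
    {w w' : 𝕜} (hw : (m : 𝕜) * w' = w) (src tgt : Λ → V) (vtx : Υ → V)
    (G : Λ → S → S → 𝕜) (G' : Λ → S' → S' → 𝕜) (P : Λ → S → S → ℝ) (θ : Λ → ℝ)
    (hP : ∀ ℓ x y, ‖G ℓ x y‖ ≤ P ℓ x y) (hP' : ∀ ℓ x' y', ‖G' ℓ x' y'‖ ≤ P ℓ (pt x') (pt y'))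
    (hQ : ∀ ℓ x' y', ‖G' ℓ x' y' - G ℓ (pt x') (pt y')‖ ≤ θ ℓ * P ℓ (pt x') (pt y'))
    (u : Υ → S → 𝕜) (u' : Υ → S' → 𝕜) (p : Υ → S → ℝ) (ϑ : Υ → ℝ)
    (hp : ∀ υ x, ‖u υ x‖ ≤ p υ x) (hp' : ∀ υ x', ‖u' υ x'‖ ≤ p υ (pt x')) (hq : ∀ υ x', ‖u' υ x' - u υ (pt x')‖ ≤ ϑ υ * p υ (pt x')) :
    ‖graphValLS w' src tgt G' vtx u' - graphValLS w src tgt G vtx u‖ ≤ (∑ ℓ, θ ℓ + ∑ υ, ϑ υ) * graphValLS ‖w‖ src tgt P vtx p := by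
  rw [graphValLS_eq_graphVal, graphValLS_eq_graphVal, graphValLS_eq_graphVal (𝕜 := ℝ)]
  have hM : ∀ φ σ, ‖lsFactor src tgt G vtx u φ σ‖ ≤ lsFactor src tgt P vtx p φ σ := by
    rintro (ℓ | υ) σ
    · exact hP ℓ _ _
    · exact hp υ _
  have hM' : ∀ φ σ', ‖lsFactor src tgt G' vtx u' φ σ'‖ ≤ lsFactor src tgt P vtx p φ (pt ∘ σ') := by
    rintro (ℓ | υ) σ'
    · exact hP' ℓ _ _
    · exact hp' υ _
  have hR : ∀ φ σ', ‖lsFactor src tgt G' vtx u' φ σ' - lsFactor src tgt G vtx u φ (pt ∘ σ')‖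
      ≤ Sum.elim θ ϑ φ * lsFactor src tgt P vtx p φ (pt ∘ σ') := by
    rintro (ℓ | υ) σ'
    · exact hQ ℓ _ _
    · exact hq υ _
  refine (norm_graphVal_sub_graphVal_le_of_ratio pt hfib hw _ _ (lsFactor src tgt P vtx p) (Sum.elim θ ϑ) hM hM' hR).trans (le_of_eq ?_)
  rw [Fintype.sum_sum_type]
  rfl
end Lines

end Summit.QuantumFields.YangMills.BalabanUVNodes.N15KingModelRung.Graph

end
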